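import Literature.MathematicalPhysics.QuantumFieldTheory.Balaban1983to89.T3AvgDivergenceSplit
import Literature.MathematicalPhysics.QuantumFieldTheory.Balaban1983to89.T3UpperAlongMinimisersSplit
import HarnessLib

/-!
# `Balaban1983to89.T3UpperLiftSplit` — rung R3, crux K1, child «MinimiserStabilityRegPr» (stmt-QuantumFields-19200), stub UPPER (HARDEST): the
# located gap G-K1a-2 (`RegularLiftAlongMinimisersAt`: exact one-step regular lifts of print's run-`K` minimisers carrying `1/L` of the action)
# SPLIT into [Balaban1985Variational] Thm 1 (9)–(10) (PRINTED, the gauge-invariant top-scale reading `MinimiserCurvGradAt` of the sibling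
# `T3AvgDivergenceSplit`) ∧ a PER-CONFIGURATION smooth-lift statement about the (0.4) averaging and the Wilson action ALONE (located gap
# G-K1a-2′, `SmoothLiftAt` — no variational problem, no minimiser in it), with the summability arithmetic of the action defect PROVED

Cell `ym3-torus` (HUMAN RULING D-0037, YM ladder rung R3), seat `ym3-torus-p1` gen 7 (UV side); cell record HOME/UV3-NODE.md §16.  WHAT THIS IS
NOT: no lift is constructed and nothing of Bałaban's is asserted — `SmoothLiftAt` and `MinimiserCurvGradAt` are HYPOTHESIS SCHEMAS; what is
PROVED is the composition into `T3UpperAlongMinimisersSplit.RegularLiftAlongMinimisersAt` under the route's prefix: the regularity of the lift at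
the finer cut-off from the thresholds, and the summability `Σ_K r_K < ∞` of the action defect along print's minimisers (d = 3 power counting).

THE POINT.  `RegularLiftAlongMinimisersAt F γ b₀ p₀ m ε₀ B₃` (G-K1a-2) asks, for `K ≥ K₀`, every `θ`-small `V` (`θ = θBal(⌊K/m⌋)`) and every
minimiser `U` over print's space (6) of run `K` lying in (8) (radius `B₃θ`), a configuration `U″` of run `K+1` with `D_{K,K+1}U″ = U`,
`U″ ∈ 𝔘_{K+1−n}(ε₀)` in full, and `β_{K+1}A(U″) ≤ β_K A(U) + r_K`, `Σ r_K < ∞`.  The minimiser enters only through two numbers: its plaquette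
bound `a = B₃θL^{−2k}` ((8), `k = K − n`) and its curvature-gradient bound `b = B₄θL^{−3k}` ([Balaban1985Variational] (9)–(10), the sibling's
`MinimiserCurvGradAt`).  Hence the split:
* **`SmoothLiftAt L C₁ C₂ c`** = located gap **G-K1a-2′** (UNPRINTED for non-abelian fields; abelian template [King1986] App. (A.5)): every
  configuration `U` on the finest lattice of run `K` with plaquettes within `a` of `1` and curvature gradients `≤ b` (`0 ≤ a, b ≤ c`) has an
  EXACT one-step lift `U″` through the family's (0.4)-averaging with plaquettes `< C₁(a + b)`, curvature gradients `≤ C₁(b + a²)`, and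
  `L·A(U″) ≤ A(U) + C₂(b² + ab + a³)·L^{3(m+K)}` (`24L^{3(m+K)}` = the number of plaquettes of that lattice; the intended witness — a smooth
  interpolation, curvature spread uniformly so that the leading cost is exactly `A(U)/L`, corrected to an exact lift by the right inverse of
  the linearised averaging — gains factors `L^{−2}`, `L^{−3}` in the two regularity clauses and has defect `O(Σ|∇F|²) + O(F³)`; the schema
  keeps the weaker, safer form with an `ab` cross term);
* **`regularLiftAlongMinimisersAt_of_split`** (PROVED): `MinimiserCurvGradAt L a₀ a₁ B₃ B₄ ∧ SmoothLiftAt L C₁ C₂ c` ⇒ `∃ ε₁′ = a₀, ∀ ε₀ ∈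
  (0, ε₁′], ∀ m ≥ 10, ∀ b₀ > 0, ∀ p₀, ∃ γ₁ > 0, ∀ F γ, F.L = L → 0 < γ ≤ γ₁ → RegularLiftAlongMinimisersAt F γ b₀ p₀ m ε₀ B₃` with `K₀ = 1` and
  the EXPLICIT GEOMETRIC radii `r_K = (C₂(B₄² + B₃B₄ + B₃³)L^{3m}/γ)·L^{−K/2}`.  Arithmetic (§2): `β_K = L^K/γ`, `b² + ab + a³ ≤ (B₄² + B₃B₄ +
  B₃³)θ²L^{−5k}` (`θ ≤ 1`), so `β_K·defect ≤ (…/γ)·L^{3m}·L^{4K−5k}`, and `L^{4K−5k} ≤ L^{−K/2}` as soon as `⌊K/m⌋ ≤ K/10` (`m ≥ 10`; with the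
  defect's printed structure `O(Σ|∇F|²) + O(F³)` and `θ(n)² ≍ γL^{−n}` the count is `m ≥ 3`, cell memo §11.3 — the cruder sufficient condition
  is chosen for a one-line geometric domination); the regularity of `U″` at run `K+1`'s cut-off: plaquettes `C₁(a + b) ≤ C₁(B₃ + B₄)θ·L^{−2k} ≤
  ε₀L^{−2(k+1)}` and divergence `2C₁(b + a²) ≤ 2C₁(B₄ + B₃²)θ·L^{−3k} < ε₀L^{−3(k+1)}` once `θ ≤ ε₀/(2C₁(B₃ + B₄)L²)`, `θ ≤ ε₀/(4C₁(B₄ + B₃²)L³)`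
  (`T3ThresholdSmallness.exists_forall_θBal_le`; the divergence via the sibling's `norm_covDivT_le_of_covDerivT_le`).
* **`stub_upper_shape_of_split`**: the BODY of the registered `stub_upper` (layer-4 birth v2 of the item, for one `L ≥ 1`) from `MinimisersIn8At`
  ([Balaban1985Variational] Prop 8, PRINTED) ∧ `MinimiserCurvGradAt` (Thm 1 (9)–(10), PRINTED) ∧ `SmoothLiftAt` (G-K1a-2′, located).
So the child's HARDEST stub = two PRINTED schemas + ONE located statement of pure lattice geometry (interpolation through the (0.4) average at
`1/L` of the Wilson action), the same shape as LOWER after `T3AvgDivergenceSplit` (G-K1a-3a′, first-order regularity of the average).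

References: T. Bałaban, CMP 102 (1985) 277–309 [Balaban1985Variational] (Thm 1 (8)–(10) p.279, Prop 8 p.304); CMP 102 (1985) 255–275
[Balaban1985UV3] ((3)/(5) p.256: `β_{K+1} = Lβ_K`); CMP 98 (1985) 17–51 [Balaban1985Averaging] (Props 3–4, (125) p.36); CMP 109 (1987) 249–301
[Balaban1987RG1] ((0.4), p.253); C. King, CMP 102 (1986) 649–677 [King1986] (App. (A.5) p.676).
-/

noncomputable section

open MeasureTheory Filter Topology
open scoped Matrix.Norms.L2Operator
open Literature.MathematicalPhysics.QuantumFieldTheory.Balaban1983to89.T3ContinuumYM3Torus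
open Literature.MathematicalPhysics.QuantumFieldTheory.Balaban1983to89.T3UnitLawDensityEML (ℰp measurableE_ℰp)
open Literature.MathematicalPhysics.QuantumFieldTheory.Balaban1983to89.T3UnitScaleTilt
open Literature.MathematicalPhysics.QuantumFieldTheory.Balaban1983to89.T3TiltDescent
open Literature.MathematicalPhysics.QuantumFieldTheory.Balaban1983to89.T3CruxEstimates
open Literature.MathematicalPhysics.QuantumFieldTheory.Balaban1983to89.T3ConstrainedMinimiser
open Literature.MathematicalPhysics.QuantumFieldTheory.Balaban1983to89.T3DescentFibreTower
open Literature.MathematicalPhysics.QuantumFieldTheory.Balaban1983to89.T3MinimiserStabilityReduction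
open Literature.MathematicalPhysics.QuantumFieldTheory.Balaban1983to89.T3RegularMinimiser
open Literature.MathematicalPhysics.QuantumFieldTheory.Balaban1983to89.T3PrintedRegularMinimiser
open Literature.MathematicalPhysics.QuantumFieldTheory.Balaban1983to89.T3PrintedRegularMinimiserReduction
open Literature.MathematicalPhysics.QuantumFieldTheory.Balaban1983to89.T3PrintedMinimiserExistence
open Literature.MathematicalPhysics.QuantumFieldTheory.Balaban1983to89.T3ThresholdSmallness (exists_forall_θBal_le)
open Literature.MathematicalPhysics.QuantumFieldTheory.Balaban1983to89.T3LowerAlongMinimisersSplit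
open Literature.MathematicalPhysics.QuantumFieldTheory.Balaban1983to89.T3UpperAlongMinimisersSplit
open Literature.MathematicalPhysics.QuantumFieldTheory.Balaban1983to89.T3AvgDivergenceSplit
open Literature.MathematicalPhysics.QuantumFieldTheory.Balaban1983to89.B10Eq27TorusAxialLog (toUField unitsField)
open Literature.MathematicalPhysics.QuantumFieldTheory.Balaban1983to89.B10Eq68TorusRegularity (plaqFT covDerivT covDivT)
open Literature.MathematicalPhysics.QuantumFieldTheory.Balaban1983to89.Missing

namespace Literature.MathematicalPhysics.QuantumFieldTheory.Balaban1983to89.T3UpperLiftSplit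

/-! ## §1 The located schema G-K1a-2′: per-configuration smooth one-step lifts at `1/L` of the Wilson action -/

section Schema

/-- **LOCATED GAP G-K1a-2′ AS A SCHEMA — SMOOTH EXACT ONE-STEP LIFTS OF SMALL, SLOWLY VARYING FIELDS** (hypothesis, never asserted; UNPRINTED
for non-abelian fields): for every configuration `U` on the finest lattice of the `K`-th approximation whose plaquette variables are within
`a` of `1` and whose plaquette fields have all backward covariant derivatives `≤ b` (`0 ≤ a, b ≤ c`), there is a configuration `U″` on the
finest lattice of the `(K+1)`-th approximation with (i) `D_{K,K+1}U″ = U` (exact lift through the family's (0.4)-averaging), (ii) plaquette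
variables within `C₁(a + b)` of `1`, (iii) curvature gradients `≤ C₁(b + a²)`, (iv) `L·A(U″) ≤ A(U) + C₂(b² + ab + a³)·L^{3(m+K)}` (Wilson
actions; `24L^{3(m+K)}` plaquettes) — the fine field carries `1/L = L^{−(4−d)}` of the coarse action up to a defect quadratic in the gradient
and cubic in the field.  Intended witness: smooth interpolation + exact correction by the right inverse of the linearised averaging
([Balaban1985Averaging] Props 3–4, (125)); abelian template [King1986] (A.5). [cite: King1986, (A.5) p.676; Balaban1985Averaging, Prop. 3 (122)-(125) p.36] -/
def SmoothLiftAt (L : ℕ) (C₁ C₂ c : ℝ) : Prop :=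
  ∀ F : T3Family, F.L = L → ∀ (K : ℕ) (a b : ℝ), 0 ≤ a → a ≤ c → 0 ≤ b → b ≤ c →
    ∀ U : GaugeField (F.P K) 0 (Matrix.specialUnitaryGroup (Fin 2) ℂ), PlaqSmall a U →
      (∀ (x : Site (F.P K) 0) (ν κ κ' : Fin (F.P K).d), κ ≠ κ' →
        ‖covDerivT 1 (unitsField (toUField U)) ν (plaqFT (unitsField (toUField U)) κ κ') x‖ ≤ b) →
        ∃ U'' : GaugeField (F.P (K + 1)) 0 (Matrix.specialUnitaryGroup (Fin 2) ℂ),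
          descendTo F ℰp K (K + 1) (Nat.le_succ K) U'' = U ∧
          PlaqSmall (C₁ * (a + b)) U'' ∧
          (∀ (x : Site (F.P (K + 1)) 0) (ν κ κ' : Fin (F.P (K + 1)).d), κ ≠ κ' →
            ‖covDerivT 1 (unitsField (toUField U'')) ν (plaqFT (unitsField (toUField U'')) κ κ') x‖ ≤ C₁ * (b + a ^ 2)) ∧
          (F.L : ℝ) * wilsonAction4 U'' ≤ wilsonAction4 U + C₂ * (b ^ 2 + a * b + a ^ 3) * (F.L : ℝ) ^ (3 * (F.m + K))

end Schema

/-! ## §2 Arithmetic: `β_K = L^K/γ`, the defect along (8) ∧ (9)–(10), and its geometric domination for `m ≥ 10` -/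

section Arithmetic

variable (F : T3Family)

/-- `d − 1 = 2` for the family (bookkeeping). [cite: Balaban1985UV3, (1)-(3) p.256] -/
private theorem d_sub_one_cast' (K : ℕ) : (((F.P K).d - 1 : ℕ) : ℝ) = 2 := by
  rw [T3Family.P_d]; norm_num

/-- `β_K = (γ·L^{−K})⁻¹` (the bare inverse coupling of run `K`). [cite: Balaban1985UV3, (3) and (5) p.256] -/
theorem scheme_β_eq (γ : ℝ) (K : ℕ) : (F.scheme ℰp γ).β K = (γ * ((F.L : ℝ)⁻¹) ^ K)⁻¹ := rfl

/-- `m ≥ 10 ⇒ 10·⌊K/m⌋ ≤ K` (bookkeeping). [folklore] -/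
private theorem ten_mul_div_le {m : ℕ} (hm : 10 ≤ m) (K : ℕ) : 10 * (K / m) ≤ K :=
  (Nat.mul_le_mul_left _ (Nat.div_le_div_left hm (by omega))).trans (Nat.mul_div_le K 10)

/-- **THE GEOMETRIC DOMINATION**: `L^{−5k}·L^{4K} ≤ (√(L⁻¹))^K` for `k = K − ⌊K/m⌋`, `m ≥ 10` (`4K − 5k ≤ −K/2` iff `⌊K/m⌋ ≤ K/10`).
[cite: Balaban1985UV3, (3) and (5) p.256] -/
theorem scale_product_le_sqrt_pow {m : ℕ} (hm : 10 ≤ m) (K : ℕ) :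
    ((F.L : ℝ)⁻¹) ^ (5 * (K - K / m)) * (F.L : ℝ) ^ (4 * K) ≤ (Real.sqrt ((F.L : ℝ)⁻¹)) ^ K := by
  have hL : (0 : ℝ) < F.L := L_cast_pos F
  have h10 := ten_mul_div_le hm K
  set x : ℝ := (F.L : ℝ)⁻¹ with hx_def
  have hx : 0 < x := inv_pos.mpr hL
  have hx1 : x ≤ 1 := inv_le_one_of_one_le₀ (by exact_mod_cast F.hL.2.le)
  have h4 : 4 * K ≤ 5 * (K - K / m) := by omega
  have h2 : K ≤ 2 * (5 * (K - K / m) - 4 * K) := by omega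
  -- `x^{5k}·L^{4K} = x^{5k − 4K}`
  have hxL : x * (F.L : ℝ) = 1 := inv_mul_cancel₀ hL.ne'
  have h1 : x ^ (5 * (K - K / m)) * (F.L : ℝ) ^ (4 * K) = x ^ (5 * (K - K / m) - 4 * K) := by
    conv_lhs => rw [show 5 * (K - K / m) = (5 * (K - K / m) - 4 * K) + 4 * K by omega, pow_add, mul_assoc, ← mul_pow, hxL,
      one_pow, mul_one]
  rw [h1]
  -- `x^e = (√x)^{2e} ≤ (√x)^K`
  have hsq : x ^ (5 * (K - K / m) - 4 * K) = (Real.sqrt x) ^ (2 * (5 * (K - K / m) - 4 * K)) := by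
    rw [pow_mul, Real.sq_sqrt hx.le]
  rw [hsq]
  exact pow_le_pow_of_le_one (Real.sqrt_nonneg _) (Real.sqrt_le_one.mpr hx1) h2

/-- **THE DEFECT ALONG (8) ∧ (9)–(10)**: with `a = B₃θL^{−2k}`, `b = B₄θL^{−3k}`, `0 ≤ θ ≤ 1`, `B₃, B₄, C₂ ≥ 0`:
`C₂(b² + ab + a³) ≤ C₂(B₄² + B₃B₄ + B₃³)·θ²·L^{−5k}`. [cite: Balaban1985Variational, Thm 1 (8)-(10) p.279] -/
theorem defect_le {B₃ B₄ C₂ θ : ℝ} (hB₃ : 0 ≤ B₃) (hC₂ : 0 ≤ C₂) (hθ1 : θ ≤ 1) (k : ℕ) :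
    C₂ * ((B₄ * θ * ((F.L : ℝ)⁻¹) ^ (3 * k)) ^ 2 +
        (B₃ * θ * ((F.L : ℝ)⁻¹) ^ (2 * k)) * (B₄ * θ * ((F.L : ℝ)⁻¹) ^ (3 * k)) +
        (B₃ * θ * ((F.L : ℝ)⁻¹) ^ (2 * k)) ^ 3) ≤
      C₂ * (B₄ ^ 2 + B₃ * B₄ + B₃ ^ 3) * θ ^ 2 * ((F.L : ℝ)⁻¹) ^ (5 * k) := by
  set x : ℝ := (F.L : ℝ)⁻¹ with hx_def
  have hx : 0 < x := inv_pos.mpr (L_cast_pos F)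
  have hx1 : x ≤ 1 := inv_le_one_of_one_le₀ (by exact_mod_cast F.hL.2.le)
  have h65 : x ^ (6 * k) ≤ x ^ (5 * k) := pow_le_pow_of_le_one hx.le hx1 (by omega)
  have hx5 : 0 ≤ x ^ (5 * k) := pow_nonneg hx.le _
  -- the three terms
  have hb2 : (B₄ * θ * x ^ (3 * k)) ^ 2 ≤ B₄ ^ 2 * θ ^ 2 * x ^ (5 * k) := by
    rw [show (B₄ * θ * x ^ (3 * k)) ^ 2 = B₄ ^ 2 * θ ^ 2 * x ^ (6 * k) by ring]
    exact mul_le_mul_of_nonneg_left h65 (by positivity)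
  have hab : (B₃ * θ * x ^ (2 * k)) * (B₄ * θ * x ^ (3 * k)) = B₃ * B₄ * θ ^ 2 * x ^ (5 * k) := by ring
  have ha3 : (B₃ * θ * x ^ (2 * k)) ^ 3 ≤ B₃ ^ 3 * θ ^ 2 * x ^ (5 * k) := by
    rw [show (B₃ * θ * x ^ (2 * k)) ^ 3 = B₃ ^ 3 * (θ ^ 2 * θ) * x ^ (6 * k) by ring]
    have hθ3 : θ ^ 2 * θ ≤ θ ^ 2 := mul_le_of_le_one_right (sq_nonneg _) hθ1
    calc B₃ ^ 3 * (θ ^ 2 * θ) * x ^ (6 * k) ≤ B₃ ^ 3 * θ ^ 2 * x ^ (6 * k) := by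
          apply mul_le_mul_of_nonneg_right _ (pow_nonneg hx.le _)
          exact mul_le_mul_of_nonneg_left hθ3 (by positivity)
      _ ≤ B₃ ^ 3 * θ ^ 2 * x ^ (5 * k) := mul_le_mul_of_nonneg_left h65 (by positivity)
  rw [hab, show C₂ * (B₄ ^ 2 + B₃ * B₄ + B₃ ^ 3) * θ ^ 2 * x ^ (5 * k) =
    C₂ * (B₄ ^ 2 * θ ^ 2 * x ^ (5 * k) + B₃ * B₄ * θ ^ 2 * x ^ (5 * k) + B₃ ^ 3 * θ ^ 2 * x ^ (5 * k)) by ring]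
  exact mul_le_mul_of_nonneg_left (by linarith) hC₂

/-- **`β_K × DEFECT ≤ r_K`, GEOMETRIC**: for `m ≥ 10`, `0 < γ`, `0 ≤ θ ≤ 1`, `k = K − ⌊K/m⌋`:
`β_K·C₂(B₄² + B₃B₄ + B₃³)θ²L^{−5k}·L^{3(m_F+K)} ≤ (C₂(B₄² + B₃B₄ + B₃³)L^{3m_F}/γ)·(√(L⁻¹))^K`.
[cite: Balaban1985UV3, (3) and (5) p.256] -/
theorem beta_mul_defect_le {m : ℕ} (hm : 10 ≤ m) {γ : ℝ} (hγ : 0 < γ) {M θ : ℝ} (hM : 0 ≤ M) (hθ : 0 ≤ θ) (hθ1 : θ ≤ 1) (K : ℕ) :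
    (F.scheme ℰp γ).β K * (M * θ ^ 2 * ((F.L : ℝ)⁻¹) ^ (5 * (K - K / m)) * (F.L : ℝ) ^ (3 * (F.m + K))) ≤
      (M * (F.L : ℝ) ^ (3 * F.m) / γ) * (Real.sqrt ((F.L : ℝ)⁻¹)) ^ K := by
  have hL : (0 : ℝ) < F.L := L_cast_pos F
  rw [scheme_β_eq]
  have hθ2 : θ ^ 2 ≤ 1 := pow_le_one₀ hθ hθ1
  have hscale := scale_product_le_sqrt_pow F hm K
  -- rewrite the left-hand side as `(M L^{3m}/γ)·θ²·(x^{5k}L^{4K})`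
  have hid : (γ * ((F.L : ℝ)⁻¹) ^ K)⁻¹ * (M * θ ^ 2 * ((F.L : ℝ)⁻¹) ^ (5 * (K - K / m)) * (F.L : ℝ) ^ (3 * (F.m + K))) =
      (M * (F.L : ℝ) ^ (3 * F.m) / γ) * (θ ^ 2 * (((F.L : ℝ)⁻¹) ^ (5 * (K - K / m)) * (F.L : ℝ) ^ (4 * K))) := by
    rw [inv_pow, mul_inv, inv_inv, show 3 * (F.m + K) = 3 * F.m + 3 * K by ring, pow_add,
      show (F.L : ℝ) ^ (4 * K) = (F.L : ℝ) ^ K * (F.L : ℝ) ^ (3 * K) by rw [← pow_add]; congr 1; ring]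
    field_simp
  rw [hid]
  refine mul_le_mul_of_nonneg_left ?_ (by positivity)
  calc θ ^ 2 * (((F.L : ℝ)⁻¹) ^ (5 * (K - K / m)) * (F.L : ℝ) ^ (4 * K))
      ≤ 1 * (Real.sqrt ((F.L : ℝ)⁻¹)) ^ K := mul_le_mul hθ2 hscale (by positivity) zero_le_one
    _ = (Real.sqrt ((F.L : ℝ)⁻¹)) ^ K := one_mul _

/-- The radii `r_K = c·(√(L⁻¹))^K` are summable (`L > 1`). [folklore] -/
private theorem summable_sqrt_geometric (c : ℝ) : Summable (fun K : ℕ => c * (Real.sqrt ((F.L : ℝ)⁻¹)) ^ K) := by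
  have hL1 : (1 : ℝ) < F.L := by exact_mod_cast F.hL.2
  have hx1 : (F.L : ℝ)⁻¹ < 1 := inv_lt_one_of_one_lt₀ hL1
  have hs : Real.sqrt ((F.L : ℝ)⁻¹) < 1 :=
    (Real.sqrt_lt_sqrt (inv_pos.mpr (L_cast_pos F)).le hx1).trans_eq Real.sqrt_one
  exact (summable_geometric_of_lt_one (Real.sqrt_nonneg _) hs).mul_left c

end Arithmetic

/-! ## §3 The composition: G-K1a-2 ⇐ Thm 1 (9)–(10) ∧ G-K1a-2′, PROVED under the route's prefix -/

section Split

/-- **G-K1a-2 ⇐ [Balaban1985Variational] THM 1 (9)–(10) ∧ G-K1a-2′** (PROVED).  Given the gauge-invariant top-scale reading of (9)–(10) for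
minimisers over (6) (`MinimiserCurvGradAt L a₀ a₁ B₃ B₄`) and the per-configuration smooth-lift schema (`SmoothLiftAt L C₁ C₂ c`) with `a₀, a₁, B₃,
B₄, C₁, c > 0`, `C₂ ≥ 0`: for every `0 < ε₀ ≤ a₀`, `m ≥ 10`, `b₀ > 0`, real `p₀` there is `γ₁ > 0` such that for all `F` with `F.L = L` and
`0 < γ ≤ γ₁`, `RegularLiftAlongMinimisersAt F γ b₀ p₀ m ε₀ B₃` holds with `K₀ = 1` and `r_K = (C₂(B₄² + B₃B₄ + B₃³)L^{3m_F}/γ)·(√(L⁻¹))^K`.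
The `γ₁` puts `θBal(i) ≤ min {1, a₁, ε₀/B₃, c/B₃, c/B₄, ε₀/(2C₁(B₃+B₄)L²), ε₀/(4C₁(B₄+B₃²)L³)}` at every height.
[cite: Balaban1985Variational, Thm 1 (8)-(10) p.279; King1986, (A.5) p.676] -/
theorem regularLiftAlongMinimisersAt_of_split {L : ℕ} {a₀ a₁ B₃ B₄ C₁ C₂ c : ℝ} (ha₀ : 0 < a₀) (ha₁ : 0 < a₁) (hB₃ : 0 < B₃)
    (hB₄ : 0 < B₄) (hC₁ : 0 < C₁) (hC₂ : 0 ≤ C₂) (hc : 0 < c) (hgrad : MinimiserCurvGradAt L a₀ a₁ B₃ B₄) (hlift : SmoothLiftAt L C₁ C₂ c) :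
    ∃ ε₁' : ℝ, 0 < ε₁' ∧ ∀ ε₀ : ℝ, 0 < ε₀ → ε₀ ≤ ε₁' → ∀ m : ℕ, 10 ≤ m → ∀ b₀ p₀ : ℝ, 0 < b₀ →
      ∃ γ₁ : ℝ, 0 < γ₁ ∧ ∀ (F : T3Family) (γ : ℝ), F.L = L → 0 < γ → γ ≤ γ₁ →
        RegularLiftAlongMinimisersAt F γ b₀ p₀ m ε₀ B₃ := by
  refine ⟨a₀, ha₀, fun ε₀ hε₀ hε₀a m hm b₀ p₀ hb => ?_⟩
  by_cases hL : 1 ≤ L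
  · have hL0 : (0 : ℝ) < (L : ℝ) := by exact_mod_cast hL
    -- the target for the thresholds at every height (`x = L⁻¹`)
    set σ : ℝ := min 1 (min a₁ (min (ε₀ / B₃) (min (c / B₃) (min (c / B₄)
      (min (ε₀ * ((L : ℝ)⁻¹) ^ 2 / (2 * C₁ * (B₃ + B₄))) (ε₀ * ((L : ℝ)⁻¹) ^ 3 / (4 * C₁ * (B₄ + B₃ ^ 2)))))))) with hσ_def
    have hσ : 0 < σ :=
      lt_min one_pos (lt_min ha₁ (lt_min (by positivity) (lt_min (by positivity) (lt_min (by positivity)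
        (lt_min (by positivity) (by positivity))))))
    obtain ⟨γ₁, hγ₁, hθ⟩ := exists_forall_θBal_le hL b₀ p₀ hσ
    refine ⟨min γ₁ 1, lt_min hγ₁ one_pos, fun F γ hF hγ hγle => ?_⟩
    subst hF
    have hγ₁' : γ ≤ γ₁ := hγle.trans (min_le_left _ _)
    have hγ1 : γ ≤ 1 := hγle.trans (min_le_right _ _)
    have hFL : 1 ≤ F.L := F.hL.2.le
    have hLF : (0 : ℝ) < F.L := L_cast_pos F
    -- the radii
    set M : ℝ := C₂ * (B₄ ^ 2 + B₃ * B₄ + B₃ ^ 3) with hM_def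
    have hM : 0 ≤ M := by positivity
    refine ⟨1, fun K => (M * (F.L : ℝ) ^ (3 * F.m) / γ) * (Real.sqrt ((F.L : ℝ)⁻¹)) ^ K, summable_sqrt_geometric F _,
      fun K => by positivity, fun K hK V hV U hU8 hmin => ?_⟩
    have hnK : K / m < K := Nat.div_lt_self (by omega) (by omega)
    -- `θ := θBal(⌊K/m⌋)` and its smallness conditions
    set θ := θBal F.L γ b₀ p₀ (K / m) with hθ_def
    have hθ0 : 0 < θ := θBal_pos hFL hγ hγ1 hb p₀ (K / m)
    have hθσ : θ ≤ σ := hθ γ hγ hγ₁' (K / m)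
    have hθ1 : θ ≤ 1 := hθσ.trans (min_le_left _ _)
    have hθa₁ : θ ≤ a₁ := hθσ.trans ((min_le_right _ _).trans (min_le_left _ _))
    have hθ3 : θ ≤ ε₀ / B₃ := hθσ.trans ((min_le_right _ _).trans ((min_le_right _ _).trans (min_le_left _ _)))
    have hθ4 : θ ≤ c / B₃ :=
      hθσ.trans ((min_le_right _ _).trans ((min_le_right _ _).trans ((min_le_right _ _).trans (min_le_left _ _))))
    have hθ5 : θ ≤ c / B₄ :=
      hθσ.trans ((min_le_right _ _).trans ((min_le_right _ _).trans ((min_le_right _ _).trans ((min_le_right _ _).trans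
        (min_le_left _ _)))))
    have hθ6 : θ ≤ ε₀ * ((F.L : ℝ)⁻¹) ^ 2 / (2 * C₁ * (B₃ + B₄)) :=
      hθσ.trans ((min_le_right _ _).trans ((min_le_right _ _).trans ((min_le_right _ _).trans ((min_le_right _ _).trans
        ((min_le_right _ _).trans (min_le_left _ _))))))
    have hθ7 : θ ≤ ε₀ * ((F.L : ℝ)⁻¹) ^ 3 / (4 * C₁ * (B₄ + B₃ ^ 2)) :=
      hθσ.trans ((min_le_right _ _).trans ((min_le_right _ _).trans ((min_le_right _ _).trans ((min_le_right _ _).trans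
        ((min_le_right _ _).trans (min_le_right _ _))))))
    have hlo : B₃ * θ ≤ ε₀ := by
      have h := mul_le_mul_of_nonneg_left hθ3 hB₃.le
      rwa [mul_div_cancel₀ _ hB₃.ne'] at h
    have hBc : B₃ * θ ≤ c := by
      have h := mul_le_mul_of_nonneg_left hθ4 hB₃.le
      rwa [mul_div_cancel₀ _ hB₃.ne'] at h
    have hB4c : B₄ * θ ≤ c := by
      have h := mul_le_mul_of_nonneg_left hθ5 hB₄.le
      rwa [mul_div_cancel₀ _ hB₄.ne'] at h
    -- the two numbers the minimiser contributes: `a = B₃θx^{2k}` ((8)) and `b = B₄θx^{3k}` ((9)–(10))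
    set x : ℝ := (F.L : ℝ)⁻¹ with hx_def
    have hx : 0 < x := inv_pos.mpr hLF
    have hx1 : x ≤ 1 := inv_le_one_of_one_le₀ (by exact_mod_cast hFL)
    set a : ℝ := regThreshold F (K / m) K (B₃ * θ) with ha_def
    have ha_eq : a = B₃ * θ * x ^ (2 * (K - K / m)) := rfl
    set b : ℝ := B₄ * θ * x ^ (3 * (K - K / m)) with hb_def
    have hxk2 : x ^ (2 * (K - K / m)) ≤ 1 := pow_le_one₀ hx.le hx1
    have hxk3 : x ^ (3 * (K - K / m)) ≤ 1 := pow_le_one₀ hx.le hx1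
    have ha0 : 0 ≤ a := by rw [ha_eq]; positivity
    have hac : a ≤ c := by rw [ha_eq]; exact (mul_le_of_le_one_right (by positivity) hxk2).trans hBc
    have hb0 : 0 ≤ b := by positivity
    have hbc : b ≤ c := (mul_le_of_le_one_right (by positivity) hxk3).trans hB4c
    -- (9)–(10) for the minimiser, which lies in (6)(ε₀) ⊇ (8)
    have hU6 : U ∈ regFibrePr F (K / m) K (Nat.div_le_self K m) ε₀ V := regFibrePr_mono F hlo V hU8
    have hder : ∀ (y : Site (F.P K) 0) (ν κ κ' : Fin (F.P K).d), κ ≠ κ' →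
        ‖covDerivT 1 (unitsField (toUField U)) ν (plaqFT (unitsField (toUField U)) κ κ') y‖ ≤ b :=
      fun y ν κ κ' hne => (hgrad F rfl (K / m) K hnK θ ε₀ hθ0 hθa₁ hlo hε₀a V hV U hU6 hmin y ν κ κ' hne).le
    -- the smooth lift
    obtain ⟨U'', hD, hplaq, hder'', hact⟩ := hlift F rfl K a b ha0 hac hb0 hbc U hU8.1.2 hder
    refine ⟨U'', hD, ⟨?_, ?_⟩, ?_⟩
    · -- plaquette clause at run `K+1`'s cut-off: `C₁(a + b) ≤ ε₀x^{2(k+1)}`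
      refine plaqSmall_of_le ?_ hplaq
      have hk1 : 2 * (K + 1 - K / m) = 2 * (K - K / m) + 2 := by omega
      show C₁ * (a + b) ≤ ε₀ * x ^ (2 * (K + 1 - K / m))
      rw [hk1, pow_add, ha_eq, hb_def]
      have hsum : B₃ * θ * x ^ (2 * (K - K / m)) + B₄ * θ * x ^ (3 * (K - K / m)) ≤ (B₃ + B₄) * θ * x ^ (2 * (K - K / m)) := by
        have h32 : x ^ (3 * (K - K / m)) ≤ x ^ (2 * (K - K / m)) := pow_le_pow_of_le_one hx.le hx1 (by omega)
        have h1 : B₄ * θ * x ^ (3 * (K - K / m)) ≤ B₄ * θ * x ^ (2 * (K - K / m)) :=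
          mul_le_mul_of_nonneg_left h32 (mul_nonneg hB₄.le hθ0.le)
        rw [show (B₃ + B₄) * θ * x ^ (2 * (K - K / m)) = B₃ * θ * x ^ (2 * (K - K / m)) + B₄ * θ * x ^ (2 * (K - K / m)) by ring]
        linarith only [h1]
      have hθ6' : C₁ * ((B₃ + B₄) * θ) ≤ ε₀ * x ^ 2 / 2 := by
        have hpos : 0 < 2 * C₁ * (B₃ + B₄) := by positivity
        have h := mul_le_mul_of_nonneg_left hθ6 hpos.le
        rw [mul_div_cancel₀ _ hpos.ne'] at h
        linarith only [h]
      calc C₁ * (B₃ * θ * x ^ (2 * (K - K / m)) + B₄ * θ * x ^ (3 * (K - K / m)))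
          ≤ C₁ * ((B₃ + B₄) * θ * x ^ (2 * (K - K / m))) := mul_le_mul_of_nonneg_left hsum hC₁.le
        _ = C₁ * ((B₃ + B₄) * θ) * x ^ (2 * (K - K / m)) := by ring
        _ ≤ (ε₀ * x ^ 2 / 2) * x ^ (2 * (K - K / m)) := mul_le_mul_of_nonneg_right hθ6' (by positivity)
        _ ≤ ε₀ * (x ^ (2 * (K - K / m)) * x ^ 2) := by
            rw [show (ε₀ * x ^ 2 / 2) * x ^ (2 * (K - K / m)) = (ε₀ * (x ^ (2 * (K - K / m)) * x ^ 2)) / 2 by ring]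
            exact half_le_self (by positivity)
    · -- divergence clause at run `K+1`'s cut-off: `2C₁(b + a²) < ε₀x^{3(k+1)}`
      intro bd
      have hdiv := norm_covDivT_le_of_covDerivT_le (unitsField (toUField U'')) (x := bd.src)
        (fun ν κ κ' hne => hder'' bd.src ν κ κ' hne) bd.dir
      rw [d_sub_one_cast'] at hdiv
      refine hdiv.trans_lt ?_
      have hk1 : 3 * (K + 1 - K / m) = 3 * (K - K / m) + 3 := by omega
      show 2 * (C₁ * (b + a ^ 2)) < ε₀ * x ^ (3 * (K + 1 - K / m))
      rw [hk1, pow_add, ha_eq, hb_def]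
      have hsum : B₄ * θ * x ^ (3 * (K - K / m)) + (B₃ * θ * x ^ (2 * (K - K / m))) ^ 2 ≤
          (B₄ + B₃ ^ 2) * θ * x ^ (3 * (K - K / m)) := by
        have h43 : x ^ (4 * (K - K / m)) ≤ x ^ (3 * (K - K / m)) := pow_le_pow_of_le_one hx.le hx1 (by omega)
        have hsq : (B₃ * θ * x ^ (2 * (K - K / m))) ^ 2 = B₃ ^ 2 * (θ * θ) * x ^ (4 * (K - K / m)) := by ring
        have hθθ : θ * θ ≤ θ := mul_le_of_le_one_right hθ0.le hθ1
        rw [hsq]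
        have h2 : B₃ ^ 2 * (θ * θ) * x ^ (4 * (K - K / m)) ≤ B₃ ^ 2 * θ * x ^ (3 * (K - K / m)) :=
          mul_le_mul (mul_le_mul_of_nonneg_left hθθ (sq_nonneg B₃)) h43 (pow_nonneg hx.le _)
            (mul_nonneg (sq_nonneg B₃) hθ0.le)
        rw [show (B₄ + B₃ ^ 2) * θ * x ^ (3 * (K - K / m)) = B₄ * θ * x ^ (3 * (K - K / m)) + B₃ ^ 2 * θ * x ^ (3 * (K - K / m)) by ring]
        linarith only [h2]
      have hθ7' : 2 * (C₁ * ((B₄ + B₃ ^ 2) * θ)) ≤ ε₀ * x ^ 3 / 2 := by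
        have hpos : 0 < 4 * C₁ * (B₄ + B₃ ^ 2) := by positivity
        have h := mul_le_mul_of_nonneg_left hθ7 hpos.le
        rw [mul_div_cancel₀ _ hpos.ne'] at h
        linarith only [h]
      have hx3k : 0 < x ^ (3 * (K - K / m)) := pow_pos hx _
      calc 2 * (C₁ * (B₄ * θ * x ^ (3 * (K - K / m)) + (B₃ * θ * x ^ (2 * (K - K / m))) ^ 2))
          ≤ 2 * (C₁ * ((B₄ + B₃ ^ 2) * θ * x ^ (3 * (K - K / m)))) := by gcongr
        _ = 2 * (C₁ * ((B₄ + B₃ ^ 2) * θ)) * x ^ (3 * (K - K / m)) := by ring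
        _ ≤ (ε₀ * x ^ 3 / 2) * x ^ (3 * (K - K / m)) := mul_le_mul_of_nonneg_right hθ7' hx3k.le
        _ < ε₀ * (x ^ (3 * (K - K / m)) * x ^ 3) := by
            rw [show (ε₀ * x ^ 3 / 2) * x ^ (3 * (K - K / m)) = (ε₀ * (x ^ (3 * (K - K / m)) * x ^ 3)) / 2 by ring]
            exact half_lt_self (by positivity)
    · -- the action: `β_{K+1}A(U″) = β_K·(L·A(U″)) ≤ β_K A(U) + β_K·defect ≤ β_K A(U) + r_K`
      have hβ : 0 ≤ (F.scheme ℰp γ).β K := by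
        rw [scheme_β_eq]; exact (inv_pos.mpr (mul_pos hγ (pow_pos hx K))).le
      rw [scheme_β_succ, show (F.L : ℝ) * (F.scheme ℰp γ).β K * wilsonAction4 U'' =
        (F.scheme ℰp γ).β K * ((F.L : ℝ) * wilsonAction4 U'') by ring]
      have hdef := defect_le F (B₄ := B₄) hB₃.le hC₂ hθ1 (K - K / m)
      have hstep : (F.scheme ℰp γ).β K * ((F.L : ℝ) * wilsonAction4 U'') ≤
          (F.scheme ℰp γ).β K * wilsonAction4 U +
            (F.scheme ℰp γ).β K * (M * θ ^ 2 * x ^ (5 * (K - K / m)) * (F.L : ℝ) ^ (3 * (F.m + K))) := by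
        rw [← mul_add]
        refine mul_le_mul_of_nonneg_left (hact.trans (add_le_add le_rfl ?_)) hβ
        have hdef' : C₂ * (b ^ 2 + a * b + a ^ 3) ≤ M * θ ^ 2 * x ^ (5 * (K - K / m)) := hdef
        exact mul_le_mul_of_nonneg_right hdef' (by positivity)
      exact hstep.trans (add_le_add le_rfl (beta_mul_defect_le F hm hγ hM hθ0.le hθ1 K))
  · -- no member of the family has block size `L < 1`
    refine ⟨1, one_pos, fun F γ hF _ _ => ?_⟩
    exact absurd (hF ▸ F.hL.2.le) hL

end Split

/-! ## §4 What the registered `stub_upper` of the layer-4 birth now rests on -/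

section StubUpper

/-- **THE BODY OF THE REGISTERED `stub_upper` (layer-4 birth v2 of stmt-QuantumFields-19200, for one `L`) FROM PRINT + G-K1a-2′**:
`MinimisersIn8At` ([Balaban1985Variational] Prop 8, PRINTED) ∧ `MinimiserCurvGradAt` (Thm 1 (9)–(10), PRINTED, gauge-invariant top-scale reading)
∧ `SmoothLiftAt` (located G-K1a-2′: per-configuration smooth exact lifts at `1/L` of the action) ⇒ `∃ a₀ a₁ B₃ > 0, MinimisersIn8At ∧ ∃ ε₁ > 0,
∀ ε₀ ∈ (0, ε₁], ∃ m₀, ∀ m ≥ m₀, ∀ b₀ > 0, ∀ p₀ > 2, ∃ γ₁ > 0, ∀ F γ, … → RegularLiftAlongMinimisersAt F γ b₀ p₀ m ε₀ B₃` verbatim as registered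
(`m₀ = 10`). [cite: Balaban1985Variational, Thm 1 (8)-(10) p.279 and Prop 8 p.304; King1986, (A.5) p.676] -/
theorem stub_upper_shape_of_split {L : ℕ} {a₀ a₁ B₃ B₄ C₁ C₂ c : ℝ} (ha₀ : 0 < a₀) (ha₁ : 0 < a₁) (hB₃ : 0 < B₃) (hB₄ : 0 < B₄)
    (hC₁ : 0 < C₁) (hC₂ : 0 ≤ C₂) (hc : 0 < c) (h8 : MinimisersIn8At L a₀ a₁ B₃) (hgrad : MinimiserCurvGradAt L a₀ a₁ B₃ B₄)
    (hlift : SmoothLiftAt L C₁ C₂ c) :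
    ∃ a₀ a₁ B₃ : ℝ, 0 < a₀ ∧ 0 < a₁ ∧ 0 < B₃ ∧ MinimisersIn8At L a₀ a₁ B₃ ∧
      ∃ ε₁ : ℝ, 0 < ε₁ ∧ ∀ (ε₀ : ℝ), 0 < ε₀ → ε₀ ≤ ε₁ → ∃ m₀ : ℕ, ∀ (m : ℕ), m₀ ≤ m → ∀ (b₀ p₀ : ℝ), 0 < b₀ → 2 < p₀ →
        ∃ γ₁ : ℝ, 0 < γ₁ ∧ ∀ (F : T3Family) (γ : ℝ), F.L = L → 0 < γ → γ ≤ γ₁ →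
          RegularLiftAlongMinimisersAt F γ b₀ p₀ m ε₀ B₃ := by
  obtain ⟨ε₁', hε₁', H⟩ := regularLiftAlongMinimisersAt_of_split ha₀ ha₁ hB₃ hB₄ hC₁ hC₂ hc hgrad hlift
  exact ⟨a₀, a₁, B₃, ha₀, ha₁, hB₃, h8, ε₁', hε₁', fun ε₀ hε₀ hε₀le => ⟨10, fun m hm b₀ p₀ hb _ => H ε₀ hε₀ hε₀le m hm b₀ p₀ hb⟩⟩

/-- **UPPER itself from the same pieces** (`UpperAlongRegPrMinimisersAt`, through the tree's `upperAlongRegPrMinimisersAt_of_split`): for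
`0 < ε₀ ≤ a₀`, `m ≥ 10`, `b₀ > 0`, real `p₀`, small `γ`. [cite: Balaban1985Variational, Thm 1 (8)-(10) p.279 and Prop 8 p.304] -/
theorem upperAlongRegPrMinimisersAt_of_split' {L : ℕ} {a₀ a₁ B₃ B₄ C₁ C₂ c : ℝ} (ha₀ : 0 < a₀) (ha₁ : 0 < a₁) (hB₃ : 0 < B₃) (hB₄ : 0 < B₄)
    (hC₁ : 0 < C₁) (hC₂ : 0 ≤ C₂) (hc : 0 < c) (h8 : MinimisersIn8At L a₀ a₁ B₃) (hgrad : MinimiserCurvGradAt L a₀ a₁ B₃ B₄)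
    (hlift : SmoothLiftAt L C₁ C₂ c) :
    ∃ ε₁' : ℝ, 0 < ε₁' ∧ ∀ ε₀ : ℝ, 0 < ε₀ → ε₀ ≤ ε₁' → ∀ m : ℕ, 10 ≤ m → ∀ b₀ p₀ : ℝ, 0 < b₀ →
      ∃ γ₁ : ℝ, 0 < γ₁ ∧ ∀ (F : T3Family) (γ : ℝ), F.L = L → 0 < γ → γ ≤ γ₁ →
        UpperAlongRegPrMinimisersAt F γ b₀ p₀ m ε₀ := by
  obtain ⟨e₁, he₁, H₁⟩ := upperAlongRegPrMinimisersAt_of_split ha₀ ha₁ hB₃ h8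
  obtain ⟨e₂, he₂, H₂⟩ := regularLiftAlongMinimisersAt_of_split ha₀ ha₁ hB₃ hB₄ hC₁ hC₂ hc hgrad hlift
  refine ⟨min e₁ e₂, lt_min he₁ he₂, fun ε₀ hε₀ hle m hm b₀ p₀ hb => ?_⟩
  obtain ⟨γa, hγa, hA⟩ := H₁ ε₀ hε₀ (hle.trans (min_le_left _ _)) m (le_trans (by norm_num) hm) b₀ p₀ hb
  obtain ⟨γb, hγb, hB⟩ := H₂ ε₀ hε₀ (hle.trans (min_le_right _ _)) m hm b₀ p₀ hb
  refine ⟨min γa γb, lt_min hγa hγb, fun F γ hF hγ hγle => ?_⟩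
  exact hA F γ hF hγ (hγle.trans (min_le_left _ _)) (hB F γ hF hγ (hγle.trans (min_le_right _ _)))

end StubUpper

end Literature.MathematicalPhysics.QuantumFieldTheory.Balaban1983to89.T3UpperLiftSplit

end
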